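import Literature.AlgebraicGeometry.HodgeTheory.DegreeOneHodgeTypes
import Mathlib.LinearAlgebra.Projection
import HarnessLib

/-!
# The Weil operator of the weight-one Hodge structure `H¹(X(ℂ); ℂ) = H^{1,0} ⊕ H^{0,1}`

Family `hodge`, layer `Literature/AlgebraicGeometry/HodgeTheory`. For a smooth projective complex
variety `X` the degree-one cohomology carries the Hodge decomposition
`H¹(X(ℂ); ℂ) = H^{1,0} ⊕ H^{0,1}` (the tree's `hodgeOneZero`, `hodgeZeroOne`,
`isCompl_hodgeOneZero_hodgeZeroOne`, `HodgeTheory/DegreeOneHodgeTypes`; Voisin I, §6.1.3 and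
Cor. 6.14), with `\overline{H^{1,0}} = H^{0,1}` (Cor. 6.12). The **Weil operator** of this weight-one
Hodge structure is the endomorphism `C` of `H¹(X(ℂ); ℂ)` acting as `i` on `H^{1,0}` and as `-i` on
`H^{0,1}` ([Deligne1982HodgeCycles, §1, p. 11: "`C` acts as `i^{p-q}` on `V^{p,q}`";
[VoisinHodgeI2002, §6.1.3]); it is REAL (`\overline{C x} = C \overline{x}`), satisfies `C² = -1`,
and is natural under pull-back by morphisms of smooth projective varieties (pull-backs preserve
Hodge types, Voisin I §7.3.2). Restricted to the real classes `H¹(X(ℂ); ℝ)` it is the complex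
structure of the weight-one real Hodge structure — for an abelian variety `A`, the complex structure
of `H¹(A(ℂ); ℝ) = Hom_ℝ(T₀A, ℝ)` ([Deligne1982HodgeCycles, 4.7]; [LangeBirkenhake1992, §1.1 and
Prop. 1.1.9]), i.e. the PERIOD POINT of `A` in Deligne's domain of complex structures (proof of
[Deligne1982HodgeCycles, Thm. 4.8], p. 48: "`X⁺` the connected component containing the complex
structure of `A`"; the tree's `LinearAlgebra.QuadraticForm.posComplexStructures`).

This file DEFINES the operator on the tree's carriers and proves its algebra; the positivity and
polarization clauses of the period point are in `HodgeTheory/WeilTypePeriodPoint`.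

* `projOneZero hX`, `projZeroOne hX` — the projections of `H¹ = H^{1,0} ⊕ H^{0,1}` (Mathlib's
  `Submodule.projection` for the tree's `isCompl_hodgeOneZero_hodgeZeroOne`), with the uniqueness
  of the decomposition (`projOneZero_eq_of_add_eq`, `projZeroOne_eq_of_add_eq`), reality
  `\overline{π^{1,0} x} = π^{0,1} \overline{x}` (`conjClass_projOneZero`) and naturality
  (`map_projOneZero`);
* `weilOperatorOne hX` — **the Weil operator `C = i π^{1,0} - i π^{0,1}`**, with
  `weilOperatorOne_of_mem_hodgeOneZero` / `…ZeroOne` (`C = ± i` on `H^{1,0}` / `H^{0,1}`),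
  `weilOperatorOne_weilOperatorOne` (**`C² = -1`**), `conjClass_weilOperatorOne` (**`C` is real**),
  `map_weilOperatorOne` (**naturality** `g^* ∘ C = C ∘ g^*`), the eigenspace descriptions
  `weilOperatorOne_eq_I_smul_iff` / `weilOperatorOne_eq_neg_I_smul_iff`, and, for REAL classes
  (`\overline{x} = x`), `projZeroOne_eq_conjClass_projOneZero` (`x = z + \overline{z}` with
  `z = π^{1,0} x`) and `projOneZero_ne_zero_of_conjClass_eq` (`z ≠ 0` for `x ≠ 0`).

Everything is proved; no named fact and no axiom is introduced (D-0026).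

## References

* [Deligne1982HodgeCycles] P. Deligne (notes by J. S. Milne), Hodge cycles on abelian varieties,
  in: Hodge Cycles, Motives, and Shimura Varieties, LNM 900 (1982), §1 (p. 11), 4.7, proof of
  Thm. 4.8 (p. 48).
* [VoisinHodgeI2002] C. Voisin, Hodge Theory and Complex Algebraic Geometry I (CUP 2002), §6.1.3
  (Cor. 6.12, Cor. 6.14), §7.1.1, §7.3.2.
* [LangeBirkenhake1992] H. Lange, Ch. Birkenhake, Complex Abelian Varieties (1992), §1.1,
  Prop. 1.1.9, Lemma 1.1.17.
-/

noncomputable section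

namespace Literature.AlgebraicGeometry.HodgeTheory

open CategoryTheory
open Literature.AlgebraicTopology.SingularHomology
open Literature.AlgebraicGeometry.Motives (IsSmoothProjective ComplexPoints)

section HodgeTheory

variable {n : ℕ} {X : Motives.SchemeOver ℂ} (hX : IsSmoothProjective n X)

/-! ### The two projections of `H¹ = H^{1,0} ⊕ H^{0,1}` -/

/-- **`π^{1,0}`**: the projection of `H¹(X(ℂ); ℂ)` onto `H^{1,0}` along `H^{0,1}`.
[cite: VoisinHodgeI2002, §6.1.3 Cor. 6.14] -/
def projOneZero : complexBetti X 1 →ₗ[ℂ] complexBetti X 1 :=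
  (hodgeOneZero hX).projection (hodgeZeroOne hX) (isCompl_hodgeOneZero_hodgeZeroOne hX)

/-- **`π^{0,1}`**: the projection of `H¹(X(ℂ); ℂ)` onto `H^{0,1}` along `H^{1,0}`.
[cite: VoisinHodgeI2002, §6.1.3 Cor. 6.14] -/
def projZeroOne : complexBetti X 1 →ₗ[ℂ] complexBetti X 1 :=
  (hodgeZeroOne hX).projection (hodgeOneZero hX) (isCompl_hodgeOneZero_hodgeZeroOne hX).symm

/-- `π^{1,0} x ∈ H^{1,0}`. [cite: VoisinHodgeI2002, §6.1.3 Cor. 6.14] -/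
theorem projOneZero_mem (x : complexBetti X 1) : projOneZero hX x ∈ hodgeOneZero hX :=
  Submodule.projection_apply_mem _ x

/-- `π^{0,1} x ∈ H^{0,1}`. [cite: VoisinHodgeI2002, §6.1.3 Cor. 6.14] -/
theorem projZeroOne_mem (x : complexBetti X 1) : projZeroOne hX x ∈ hodgeZeroOne hX :=
  Submodule.projection_apply_mem _ x

/-- `x = π^{1,0} x + π^{0,1} x`. [cite: VoisinHodgeI2002, §6.1.3 Cor. 6.14] -/
theorem projOneZero_add_projZeroOne (x : complexBetti X 1) :
    projOneZero hX x + projZeroOne hX x = x :=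
  Submodule.projection_add_projection_eq_self _ x

/-- `π^{1,0} = 1` on `H^{1,0}`. [folklore] -/
theorem projOneZero_of_mem_hodgeOneZero {x : complexBetti X 1} (hx : x ∈ hodgeOneZero hX) :
    projOneZero hX x = x :=
  Submodule.projection_apply_of_mem_left _ hx

/-- `π^{1,0} = 0` on `H^{0,1}`. [folklore] -/
theorem projOneZero_of_mem_hodgeZeroOne {x : complexBetti X 1} (hx : x ∈ hodgeZeroOne hX) :
    projOneZero hX x = 0 :=
  (Submodule.projection_apply_eq_zero_iff _).2 hx

/-- `π^{0,1} = 1` on `H^{0,1}`. [folklore] -/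
theorem projZeroOne_of_mem_hodgeZeroOne {x : complexBetti X 1} (hx : x ∈ hodgeZeroOne hX) :
    projZeroOne hX x = x :=
  Submodule.projection_apply_of_mem_left _ hx

/-- `π^{0,1} = 0` on `H^{1,0}`. [folklore] -/
theorem projZeroOne_of_mem_hodgeOneZero {x : complexBetti X 1} (hx : x ∈ hodgeOneZero hX) :
    projZeroOne hX x = 0 :=
  (Submodule.projection_apply_eq_zero_iff _).2 hx

/-- **Uniqueness of the decomposition**, first component: if `x = a + b` with `a ∈ H^{1,0}`,
`b ∈ H^{0,1}`, then `π^{1,0} x = a`. [cite: VoisinHodgeI2002, §6.1.3 Cor. 6.14] -/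
theorem projOneZero_eq_of_add_eq {x a b : complexBetti X 1} (ha : a ∈ hodgeOneZero hX)
    (hb : b ∈ hodgeZeroOne hX) (h : a + b = x) : projOneZero hX x = a := by
  rw [← h, map_add, projOneZero_of_mem_hodgeOneZero hX ha, projOneZero_of_mem_hodgeZeroOne hX hb,
    add_zero]

/-- **Uniqueness of the decomposition**, second component: if `x = a + b` with `a ∈ H^{1,0}`,
`b ∈ H^{0,1}`, then `π^{0,1} x = b`. [cite: VoisinHodgeI2002, §6.1.3 Cor. 6.14] -/
theorem projZeroOne_eq_of_add_eq {x a b : complexBetti X 1} (ha : a ∈ hodgeOneZero hX)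
    (hb : b ∈ hodgeZeroOne hX) (h : a + b = x) : projZeroOne hX x = b := by
  rw [← h, map_add, projZeroOne_of_mem_hodgeOneZero hX ha, projZeroOne_of_mem_hodgeZeroOne hX hb,
    zero_add]

/-- `π^{1,0} x = 0 ↔ x ∈ H^{0,1}`. [folklore] -/
theorem projOneZero_eq_zero_iff {x : complexBetti X 1} : projOneZero hX x = 0 ↔ x ∈ hodgeZeroOne hX :=
  Submodule.projection_apply_eq_zero_iff _

/-- `π^{0,1} x = 0 ↔ x ∈ H^{1,0}`. [folklore] -/
theorem projZeroOne_eq_zero_iff {x : complexBetti X 1} : projZeroOne hX x = 0 ↔ x ∈ hodgeOneZero hX :=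
  Submodule.projection_apply_eq_zero_iff _

/-- `conj (-c) = -conj c` on `Hᵏ(Y; ℂ)`. [folklore] -/
theorem conjClass_neg {Y : Type} [TopologicalSpace Y] {k : ℕ} (c : singularCohomology ℂ ℂ Y k) :
    conjClass Y k (-c) = -conjClass Y k c := by
  rw [← neg_one_smul ℂ c, conjClass_smul, map_neg, map_one, neg_one_smul]

/-- `conj (c - c') = conj c - conj c'` on `Hᵏ(Y; ℂ)`. [folklore] -/
theorem conjClass_sub {Y : Type} [TopologicalSpace Y] {k : ℕ} (c c' : singularCohomology ℂ ℂ Y k) :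
    conjClass Y k (c - c') = conjClass Y k c - conjClass Y k c' := by
  rw [sub_eq_add_neg, conjClass_add, conjClass_neg, ← sub_eq_add_neg]

/-- `conj (i • c) = -(i • conj c)`. [folklore] -/
theorem conjClass_I_smul {Y : Type} [TopologicalSpace Y] {k : ℕ} (c : singularCohomology ℂ ℂ Y k) :
    conjClass Y k (Complex.I • c) = -(Complex.I • conjClass Y k c) := by
  rw [conjClass_smul, Complex.conj_I, neg_smul]

/-- **Reality of the decomposition: `\overline{π^{1,0} x} = π^{0,1} \overline{x}`** (conjugation
exchanges `H^{1,0}` and `H^{0,1}`, Voisin I Cor. 6.12, and the decomposition is unique).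
[cite: VoisinHodgeI2002, §6.1.3 Cor. 6.12 and Cor. 6.14] -/
theorem conjClass_projOneZero (x : complexBetti X 1) :
    conjClass (ComplexPoints X) 1 (projOneZero hX x) = projZeroOne hX (conjClass (ComplexPoints X) 1 x) := by
  symm
  refine projZeroOne_eq_of_add_eq hX (a := conjClass (ComplexPoints X) 1 (projZeroOne hX x))
    (conjClass_mem_hodgeOneZero hX (projZeroOne_mem hX x))
    (conjClass_mem_hodgeZeroOne hX (projOneZero_mem hX x)) ?_
  rw [← conjClass_add, add_comm, projOneZero_add_projZeroOne]

/-- **`\overline{π^{0,1} x} = π^{1,0} \overline{x}`.** [cite: VoisinHodgeI2002, §6.1.3 Cor. 6.12 and Cor. 6.14] -/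
theorem conjClass_projZeroOne (x : complexBetti X 1) :
    conjClass (ComplexPoints X) 1 (projZeroOne hX x) = projOneZero hX (conjClass (ComplexPoints X) 1 x) := by
  symm
  refine projOneZero_eq_of_add_eq hX (b := conjClass (ComplexPoints X) 1 (projOneZero hX x))
    (conjClass_mem_hodgeOneZero hX (projZeroOne_mem hX x))
    (conjClass_mem_hodgeZeroOne hX (projOneZero_mem hX x)) ?_
  rw [← conjClass_add, add_comm, projOneZero_add_projZeroOne]

/-- **Naturality of `π^{1,0}`** under pull-back by a morphism `g : Y ⟶ X` of smooth projective
varieties: `π^{1,0}_Y (g^* x) = g^* (π^{1,0}_X x)` (pull-backs preserve Hodge types, Voisin I §7.3.2;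
the tree's `IsOfHodgeType.map_of_isSmoothProjective`). [cite: VoisinHodgeI2002, §7.3.2] -/
theorem map_projOneZero {m : ℕ} {Y : Motives.SchemeOver ℂ} (hY : IsSmoothProjective m Y) (g : Y ⟶ X)
    (x : complexBetti X 1) :
    projOneZero hY (complexBetti.map g 1 (projOneZero hX x)) = complexBetti.map g 1 (projOneZero hX x) ∧
    projOneZero hY (complexBetti.map g 1 x) = complexBetti.map g 1 (projOneZero hX x) := by
  have ha : complexBetti.map g 1 (projOneZero hX x) ∈ hodgeOneZero hY :=
    IsOfHodgeType.map_of_isSmoothProjective ((mem_hodgeOneZero hX).1 (projOneZero_mem hX x)) hY hX g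
  have hb : complexBetti.map g 1 (projZeroOne hX x) ∈ hodgeZeroOne hY :=
    IsOfHodgeType.map_of_isSmoothProjective ((mem_hodgeZeroOne hX).1 (projZeroOne_mem hX x)) hY hX g
  refine ⟨projOneZero_of_mem_hodgeOneZero hY ha, projOneZero_eq_of_add_eq hY ha hb ?_⟩
  rw [← map_add, projOneZero_add_projZeroOne]

/-- **Naturality of `π^{0,1}`**: `π^{0,1}_Y (g^* x) = g^* (π^{0,1}_X x)`. [cite: VoisinHodgeI2002, §7.3.2] -/
theorem map_projZeroOne {m : ℕ} {Y : Motives.SchemeOver ℂ} (hY : IsSmoothProjective m Y) (g : Y ⟶ X)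
    (x : complexBetti X 1) :
    projZeroOne hY (complexBetti.map g 1 x) = complexBetti.map g 1 (projZeroOne hX x) := by
  have ha : complexBetti.map g 1 (projOneZero hX x) ∈ hodgeOneZero hY :=
    IsOfHodgeType.map_of_isSmoothProjective ((mem_hodgeOneZero hX).1 (projOneZero_mem hX x)) hY hX g
  have hb : complexBetti.map g 1 (projZeroOne hX x) ∈ hodgeZeroOne hY :=
    IsOfHodgeType.map_of_isSmoothProjective ((mem_hodgeZeroOne hX).1 (projZeroOne_mem hX x)) hY hX g
  refine projZeroOne_eq_of_add_eq hY ha hb ?_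
  rw [← map_add, projOneZero_add_projZeroOne]

/-! ### The Weil operator -/

/-- **The Weil operator of the weight-one Hodge structure on `H¹(X(ℂ); ℂ)`**: `C = i` on `H^{1,0}`
and `C = -i` on `H^{0,1}`, i.e. `C = i π^{1,0} - i π^{0,1}` ("`C` acts as `i^{p-q}` on `V^{p,q}`").
Restricted to `H¹(X(ℂ); ℝ)` it is the complex structure of the real weight-one Hodge structure; for
an abelian variety, the period point of `A` in Deligne's domain `X⁺`.
[cite: Deligne1982HodgeCycles, §1 (p. 11) and proof of Thm. 4.8 (p. 48)] [cite: VoisinHodgeI2002, §6.1.3] -/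
def weilOperatorOne : complexBetti X 1 →ₗ[ℂ] complexBetti X 1 :=
  Complex.I • projOneZero hX - Complex.I • projZeroOne hX

/-- `C x = i π^{1,0} x - i π^{0,1} x`. [cite: Deligne1982HodgeCycles, §1 (p. 11)] -/
theorem weilOperatorOne_apply (x : complexBetti X 1) :
    weilOperatorOne hX x = Complex.I • projOneZero hX x - Complex.I • projZeroOne hX x :=
  rfl

/-- `C (a + b) = i a - i b` for `a ∈ H^{1,0}`, `b ∈ H^{0,1}`. [cite: Deligne1982HodgeCycles, §1 (p. 11)] -/
theorem weilOperatorOne_add_of_mem {a b : complexBetti X 1} (ha : a ∈ hodgeOneZero hX)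
    (hb : b ∈ hodgeZeroOne hX) : weilOperatorOne hX (a + b) = Complex.I • a - Complex.I • b := by
  rw [weilOperatorOne_apply, projOneZero_eq_of_add_eq hX ha hb rfl, projZeroOne_eq_of_add_eq hX ha hb rfl]

/-- **`C = i` on `H^{1,0}`.** [cite: Deligne1982HodgeCycles, §1 (p. 11)] [cite: VoisinHodgeI2002, §6.1.3] -/
theorem weilOperatorOne_of_mem_hodgeOneZero {x : complexBetti X 1} (hx : x ∈ hodgeOneZero hX) :
    weilOperatorOne hX x = Complex.I • x := by
  rw [weilOperatorOne_apply, projOneZero_of_mem_hodgeOneZero hX hx,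
    projZeroOne_of_mem_hodgeOneZero hX hx, smul_zero, sub_zero]

/-- **`C = -i` on `H^{0,1}`.** [cite: Deligne1982HodgeCycles, §1 (p. 11)] [cite: VoisinHodgeI2002, §6.1.3] -/
theorem weilOperatorOne_of_mem_hodgeZeroOne {x : complexBetti X 1} (hx : x ∈ hodgeZeroOne hX) :
    weilOperatorOne hX x = -(Complex.I • x) := by
  rw [weilOperatorOne_apply, projOneZero_of_mem_hodgeZeroOne hX hx,
    projZeroOne_of_mem_hodgeZeroOne hX hx, smul_zero, zero_sub]

/-- `π^{1,0} (C x) = i π^{1,0} x`. [folklore] -/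
theorem projOneZero_weilOperatorOne (x : complexBetti X 1) :
    projOneZero hX (weilOperatorOne hX x) = Complex.I • projOneZero hX x := by
  rw [weilOperatorOne_apply, sub_eq_add_neg, ← smul_neg]
  exact projOneZero_eq_of_add_eq hX (Submodule.smul_mem _ _ (projOneZero_mem hX x))
    (Submodule.smul_mem _ _ (Submodule.neg_mem _ (projZeroOne_mem hX x))) rfl

/-- `π^{0,1} (C x) = -i π^{0,1} x`. [folklore] -/
theorem projZeroOne_weilOperatorOne (x : complexBetti X 1) :
    projZeroOne hX (weilOperatorOne hX x) = -(Complex.I • projZeroOne hX x) := by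
  rw [weilOperatorOne_apply, sub_eq_add_neg, ← smul_neg]
  rw [projZeroOne_eq_of_add_eq hX (Submodule.smul_mem _ _ (projOneZero_mem hX x))
    (Submodule.smul_mem _ _ (Submodule.neg_mem _ (projZeroOne_mem hX x))) rfl, smul_neg]

/-- **`C² = -1`** (`C` is a complex structure on `H¹`): `C (C x) = -x`.
[cite: Deligne1982HodgeCycles, §1 (p. 11)] [cite: VoisinHodgeI2002, §6.1.3] -/
theorem weilOperatorOne_weilOperatorOne (x : complexBetti X 1) :
    weilOperatorOne hX (weilOperatorOne hX x) = -x := by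
  conv_lhs => rw [weilOperatorOne_apply]
  rw [projOneZero_weilOperatorOne, projZeroOne_weilOperatorOne, smul_neg, smul_smul, smul_smul,
    Complex.I_mul_I, neg_one_smul, neg_one_smul, sub_neg_eq_add, ← neg_add,
    projOneZero_add_projZeroOne]

/-- **`C² = -1`** as an identity of endomorphisms: `C ∘ C = -id`. [cite: Deligne1982HodgeCycles, §1 (p. 11)] -/
theorem weilOperatorOne_comp_weilOperatorOne :
    weilOperatorOne hX ∘ₗ weilOperatorOne hX = -LinearMap.id :=
  LinearMap.ext fun x ↦ by
    rw [LinearMap.comp_apply, weilOperatorOne_weilOperatorOne, LinearMap.neg_apply, LinearMap.id_apply]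

/-- **`C² = -1`** in the endomorphism ring: `C * C = -1`. [cite: Deligne1982HodgeCycles, §1 (p. 11)] -/
theorem weilOperatorOne_mul_weilOperatorOne :
    weilOperatorOne hX * weilOperatorOne hX = -1 :=
  weilOperatorOne_comp_weilOperatorOne hX

/-- `C` is injective (indeed `C⁻¹ = -C`). [folklore] -/
theorem weilOperatorOne_injective : Function.Injective (weilOperatorOne hX) := fun x y h ↦ by
  have h' := congrArg (weilOperatorOne hX) h
  rwa [weilOperatorOne_weilOperatorOne, weilOperatorOne_weilOperatorOne, neg_inj] at h'

/-- **The Weil operator is real: `\overline{C x} = C \overline{x}`** (conjugation exchanges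
`H^{1,0}` and `H^{0,1}` and `\overline{i} = -i`). Hence `C` preserves the real classes
`H¹(X(ℂ); ℝ) ⊂ H¹(X(ℂ); ℂ)`. [cite: VoisinHodgeI2002, §6.1.3 Cor. 6.12] [cite: Deligne1982HodgeCycles, §1 (p. 11)] -/
theorem conjClass_weilOperatorOne (x : complexBetti X 1) :
    conjClass (ComplexPoints X) 1 (weilOperatorOne hX x) =
      weilOperatorOne hX (conjClass (ComplexPoints X) 1 x) := by
  rw [weilOperatorOne_apply, weilOperatorOne_apply, conjClass_sub, conjClass_I_smul, conjClass_I_smul,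
    conjClass_projOneZero, conjClass_projZeroOne]
  abel

/-- **Naturality of the Weil operator: `C_Y (g^* x) = g^* (C_X x)`** for a morphism `g : Y ⟶ X` of
smooth projective varieties (`g^*` is a morphism of Hodge structures, Voisin I §7.3.2). In
particular every endomorphism of `X` commutes with `C` on `H¹(X(ℂ); ℂ)`. [cite: VoisinHodgeI2002, §7.3.2] -/
theorem map_weilOperatorOne {m : ℕ} {Y : Motives.SchemeOver ℂ} (hY : IsSmoothProjective m Y) (g : Y ⟶ X)
    (x : complexBetti X 1) :
    weilOperatorOne hY (complexBetti.map g 1 x) = complexBetti.map g 1 (weilOperatorOne hX x) := by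
  rw [weilOperatorOne_apply, weilOperatorOne_apply, (map_projOneZero hX hY g x).2, map_projZeroOne hX hY g x,
    map_sub, map_smul, map_smul]

/-- **Endomorphisms commute with the Weil operator**: `C ∘ g^* = g^* ∘ C` on `H¹(X(ℂ); ℂ)` for
`g : X ⟶ X`. [cite: VoisinHodgeI2002, §7.3.2] -/
theorem weilOperatorOne_comp_map (g : X ⟶ X) :
    weilOperatorOne hX ∘ₗ (complexBetti.map g 1).hom = (complexBetti.map g 1).hom ∘ₗ weilOperatorOne hX :=
  LinearMap.ext fun x ↦ map_weilOperatorOne hX hX g x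

/-- `Commute C g^*` in the endomorphism ring of `H¹(X(ℂ); ℂ)`. [cite: VoisinHodgeI2002, §7.3.2] -/
theorem commute_weilOperatorOne_map (g : X ⟶ X) :
    Commute (weilOperatorOne hX) (complexBetti.map g 1).hom :=
  weilOperatorOne_comp_map hX g

/-! ### Eigenspaces of `C` and real classes -/

/-- `2 i ≠ 0` in `ℂ`. [folklore] -/
private theorem two_I_ne_zero : (2 : ℂ) * Complex.I ≠ 0 :=
  mul_ne_zero two_ne_zero Complex.I_ne_zero

/-- **`H^{1,0}` is the `i`-eigenspace of `C`**: `C x = i x ↔ x ∈ H^{1,0}`.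
[cite: Deligne1982HodgeCycles, §1 (p. 11)] [cite: VoisinHodgeI2002, §6.1.3] -/
theorem weilOperatorOne_eq_I_smul_iff {x : complexBetti X 1} :
    weilOperatorOne hX x = Complex.I • x ↔ x ∈ hodgeOneZero hX := by
  refine ⟨fun h ↦ ?_, weilOperatorOne_of_mem_hodgeOneZero hX⟩
  rw [← projZeroOne_eq_zero_iff hX]
  have h2 : ((2 : ℂ) * Complex.I) • projZeroOne hX x = 0 := by
    have hx := projOneZero_add_projZeroOne hX x
    rw [weilOperatorOne_apply] at h
    conv_rhs at h => rw [← hx]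
    rw [smul_add, sub_eq_add_neg, add_right_inj, neg_eq_iff_add_eq_zero, ← add_smul, ← two_mul] at h
    exact h
  exact (smul_eq_zero.1 h2).resolve_left two_I_ne_zero

/-- **`H^{0,1}` is the `-i`-eigenspace of `C`**: `C x = -i x ↔ x ∈ H^{0,1}`.
[cite: Deligne1982HodgeCycles, §1 (p. 11)] [cite: VoisinHodgeI2002, §6.1.3] -/
theorem weilOperatorOne_eq_neg_I_smul_iff {x : complexBetti X 1} :
    weilOperatorOne hX x = -(Complex.I • x) ↔ x ∈ hodgeZeroOne hX := by
  refine ⟨fun h ↦ ?_, weilOperatorOne_of_mem_hodgeZeroOne hX⟩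
  rw [← projOneZero_eq_zero_iff hX]
  have h2 : ((2 : ℂ) * Complex.I) • projOneZero hX x = 0 := by
    have hx := projOneZero_add_projZeroOne hX x
    rw [weilOperatorOne_apply] at h
    conv_rhs at h => rw [← hx]
    rw [smul_add, neg_add, sub_eq_add_neg, add_left_inj, eq_neg_iff_add_eq_zero, ← add_smul,
      ← two_mul] at h
    exact h
  exact (smul_eq_zero.1 h2).resolve_left two_I_ne_zero

/-- **A real class is `z + \overline{z}` with `z = π^{1,0} x`**: if `\overline{x} = x` then
`π^{0,1} x = \overline{π^{1,0} x}`. [cite: VoisinHodgeI2002, §6.1.3 Cor. 6.12 and Cor. 6.14] -/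
theorem projZeroOne_eq_conjClass_projOneZero {x : complexBetti X 1}
    (hx : conjClass (ComplexPoints X) 1 x = x) :
    projZeroOne hX x = conjClass (ComplexPoints X) 1 (projOneZero hX x) := by
  rw [conjClass_projOneZero, hx]

/-- For a real class `x`: `x = π^{1,0} x + \overline{π^{1,0} x}`. [cite: VoisinHodgeI2002, §6.1.3 Cor. 6.12] -/
theorem projOneZero_add_conjClass_projOneZero {x : complexBetti X 1}
    (hx : conjClass (ComplexPoints X) 1 x = x) :
    projOneZero hX x + conjClass (ComplexPoints X) 1 (projOneZero hX x) = x := by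
  rw [← projZeroOne_eq_conjClass_projOneZero hX hx, projOneZero_add_projZeroOne]

/-- **A non-zero real class has a non-zero `(1,0)`-component.** [cite: VoisinHodgeI2002, §6.1.3 Cor. 6.12] -/
theorem projOneZero_ne_zero_of_conjClass_eq {x : complexBetti X 1}
    (hx : conjClass (ComplexPoints X) 1 x = x) (hx0 : x ≠ 0) : projOneZero hX x ≠ 0 := by
  intro h0
  apply hx0
  rw [← projOneZero_add_conjClass_projOneZero hX hx, h0, conjClass_zero, add_zero]

/-- For a real class `x`: `C x = i z - i \overline{z}` with `z = π^{1,0} x`. [cite: Deligne1982HodgeCycles, §1 (p. 11)] -/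
theorem weilOperatorOne_of_conjClass_eq {x : complexBetti X 1} (hx : conjClass (ComplexPoints X) 1 x = x) :
    weilOperatorOne hX x =
      Complex.I • projOneZero hX x - Complex.I • conjClass (ComplexPoints X) 1 (projOneZero hX x) := by
  rw [weilOperatorOne_apply, projZeroOne_eq_conjClass_projOneZero hX hx]

/-- `C` preserves real classes: `\overline{x} = x → \overline{C x} = C x`. [cite: VoisinHodgeI2002, §6.1.3 Cor. 6.12] -/
theorem conjClass_weilOperatorOne_of_conjClass_eq {x : complexBetti X 1}
    (hx : conjClass (ComplexPoints X) 1 x = x) :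
    conjClass (ComplexPoints X) 1 (weilOperatorOne hX x) = weilOperatorOne hX x := by
  rw [conjClass_weilOperatorOne, hx]

end HodgeTheory

end Literature.AlgebraicGeometry.HodgeTheory

end
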